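import Mathlib
import Literature.Probability.Percolation.LoopRepresentationProofs
import Literature.Probability.Percolation.LoopRotationInvarianceProofs
import Literature.Probability.Percolation.InterfaceLoopDeterminism
import Literature.Probability.Percolation.MedialLoopStretch
import Literature.Probability.Percolation.FKLoopNestingIntegrable
import Literature.Probability.Percolation.InterfaceScalingLimitProofs
import Literature.Probability.RandomPlanarGeometry.CurveSystemTightness
import HarnessLib

/-!
# Soft machine, brick 10: typed windowed loop collections of bond-`ℤ²` — finiteness, measurability, the
# short-distance cutoff, and tightness FROM the multiple-traversal estimate

Crux `Summit.CriticalPhenomena.CardyFormulaZ2.Theses.CardyMagicRigidity.NestingRigidity`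
(stmt-CriticalPhenomena-4835), line `positive-cone-weight-doubling`, registered stub `stub_tamePrecompactness :
TamePrecompact zEns ∧ TamePrecompact tEns`.  The bond-`ℤ²` inputs of THE SOFT MACHINE (`softMachine_limit`): the
typed windowed collection is, inline throughout (no definition),

  `Closeds.closure (loopCurve δ 0 '' {γ | IsInterfaceLoop ω γ ∧ loopType γ = i ∧ (loopCurve δ 0 γ).range ⊆ B̄(0, r)})`

— the classes of the medial polygons of the WHOLE-PLANE interface loops of type `i` with trace in the closed disc
(so faithfulness to `bondLoopConfig δ 0 ω` is tautological).  Proved here: finiteness of the generating set at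
`δ > 0` (`finite_setOf_exists_isInterfaceLoop`), whence compact loop values; measurability and finite range
(factoring through the finitely many candidate loops, as `measurable_bondLoopCollection`); the SHORT-DISTANCE
CUTOFF (H0) for medial polygons of interface lists (`SoftMachine.not_hasTraversals_loopPolyline`: consecutive darts
are pairwise distinct, `IsInterfaceLoop.nodup`, and boundedly many darts live near a ball of radius `≤ δ`); and
the TIGHTNESS of the laws on the Aizenman–Burchard space GIVEN the multiple-traversal estimate (H1) for the
whole-plane interface loops of critical bond percolation (`softMachine_isTightLaws_bondWinColl_of_traversalBound`,
registered anchor; the estimate — RSW + BK on `ℤ²`, the bond analogue of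
`triSitePercolation_exists_loop_hasTraversals_le` — is the hypothesis, written inline).
-/

noncomputable section

open MeasureTheory Set Filter Metric TopologicalSpace Function
open scoped Topology ENNReal NNReal

namespace Summit.CriticalPhenomena.CardyFormulaZ2.Cruxes.NestingRigidity.PositiveConeWeightDoubling

open Literature.Probability.RandomPlanarGeometry Literature.Probability.Percolation
  Literature.Probability.LatticeModels

namespace SoftMachine

/-! ### Finiteness, compactness, loops -/

/-- At positive mesh the typed generating set of interface lists with trace in `B̄(0, r)` is finite
(`finite_setOf_exists_isInterfaceLoop`). -/
theorem finite_bondWinLists {δ : ℝ} (hδ : 0 < δ) (r : ℝ) (i : Fin 2) (ω : BondConfig (Site 2)) :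
    {γ : List MedialVertex | IsInterfaceLoop ω γ ∧ loopType γ = i ∧
      (loopCurve δ 0 γ).range ⊆ closedBall (0 : ℂ) r}.Finite :=
  (finite_setOf_exists_isInterfaceLoop hδ 0 isBounded_closedBall).subset fun _ ⟨h, _, hr⟩ ↦ ⟨⟨ω, h⟩, hr⟩

/-- At positive mesh the typed windowed bond collection IS the (finite) image of its generating set. -/
theorem coe_bondWinColl {δ : ℝ} (hδ : 0 < δ) (r : ℝ) (i : Fin 2) (ω : BondConfig (Site 2)) :
    ((Closeds.closure (loopCurve δ 0 '' {γ : List MedialVertex | IsInterfaceLoop ω γ ∧ loopType γ = i ∧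
        (loopCurve δ 0 γ).range ⊆ closedBall (0 : ℂ) r}) : LoopSpace ℂ) : Set (CurveClass ℂ)) =
      loopCurve δ 0 '' {γ : List MedialVertex | IsInterfaceLoop ω γ ∧ loopType γ = i ∧
        (loopCurve δ 0 γ).range ⊆ closedBall (0 : ℂ) r} := by
  change closure _ = _
  exact ((finite_bondWinLists hδ r i ω).image _).isClosed.closure_eq

/-- At positive mesh the typed windowed bond collection is a compact set of loops. -/
theorem isCompact_and_isLoop_bondWinColl {δ : ℝ} (hδ : 0 < δ) (r : ℝ) (i : Fin 2) (ω : BondConfig (Site 2)) :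
    IsCompact ((Closeds.closure (loopCurve δ 0 '' {γ : List MedialVertex | IsInterfaceLoop ω γ ∧ loopType γ = i ∧
        (loopCurve δ 0 γ).range ⊆ closedBall (0 : ℂ) r}) : LoopSpace ℂ) : Set (CurveClass ℂ)) ∧
    ∀ c ∈ (Closeds.closure (loopCurve δ 0 '' {γ : List MedialVertex | IsInterfaceLoop ω γ ∧ loopType γ = i ∧
        (loopCurve δ 0 γ).range ⊆ closedBall (0 : ℂ) r}) : LoopSpace ℂ), CurveClass.IsLoop c := by
  refine ⟨?_, fun c hc ↦ ?_⟩
  · rw [coe_bondWinColl hδ]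
    exact ((finite_bondWinLists hδ r i ω).image _).isCompact
  · have hc' : c ∈ ((Closeds.closure (loopCurve δ 0 '' {γ : List MedialVertex | IsInterfaceLoop ω γ ∧
        loopType γ = i ∧ (loopCurve δ 0 γ).range ⊆ closedBall (0 : ℂ) r}) : LoopSpace ℂ) : Set (CurveClass ℂ)) := hc
    rw [coe_bondWinColl hδ] at hc'
    obtain ⟨γ, ⟨h, -, -⟩, rfl⟩ := hc'
    exact isLoop_loopCurve δ 0 h.ne_nil

/-! ### Measurability and finite range -/

/-- At fixed positive mesh the typed windowed bond collection is a measurable function of the configuration with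
finitely many values (it factors through the subsets of the finite set of candidate loops). -/
theorem measurable_and_finite_range_bondWinColl {δ : ℝ} (hδ : 0 < δ) (r : ℝ) (i : Fin 2) :
    Measurable (fun ω : BondConfig (Site 2) ↦ (Closeds.closure (loopCurve δ 0 ''
      {γ : List MedialVertex | IsInterfaceLoop ω γ ∧ loopType γ = i ∧
        (loopCurve δ 0 γ).range ⊆ closedBall (0 : ℂ) r}) : LoopSpace ℂ)) ∧
    (Set.range fun ω : BondConfig (Site 2) ↦ (Closeds.closure (loopCurve δ 0 ''
      {γ : List MedialVertex | IsInterfaceLoop ω γ ∧ loopType γ = i ∧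
        (loopCurve δ 0 γ).range ⊆ closedBall (0 : ℂ) r}) : LoopSpace ℂ)).Finite := by
  set T := {γ : List MedialVertex | (∃ ω, IsInterfaceLoop ω γ) ∧ (loopCurve δ 0 γ).range ⊆ closedBall (0 : ℂ) r}
    with hT
  haveI : Finite T := (finite_setOf_exists_isInterfaceLoop hδ 0 isBounded_closedBall).to_subtype
  let Φ : BondConfig (Site 2) → Set T := fun ω ↦ {γ | IsInterfaceLoop ω γ.1}
  let G : Set T → LoopSpace ℂ := fun A ↦ Closeds.closure (loopCurve δ 0 ''
    (Subtype.val '' {γ : T | γ ∈ A ∧ loopType γ.1 = i}))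
  have hΦ : Measurable Φ := measurable_set_iff.2 fun γ ↦ measurable_isInterfaceLoop γ.1
  have hG : Measurable G := measurable_of_finite G
  have hfac : (fun ω : BondConfig (Site 2) ↦ (Closeds.closure (loopCurve δ 0 ''
      {γ : List MedialVertex | IsInterfaceLoop ω γ ∧ loopType γ = i ∧
        (loopCurve δ 0 γ).range ⊆ closedBall (0 : ℂ) r}) : LoopSpace ℂ)) = G ∘ Φ := by
    funext ω
    refine Closeds.ext ?_
    change closure (loopCurve δ 0 '' _) = closure (loopCurve δ 0 '' (Subtype.val '' _))
    congr 2
    ext γ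
    constructor
    · rintro ⟨h, ht, hr⟩
      exact ⟨⟨γ, ⟨ω, h⟩, hr⟩, ⟨h, ht⟩, rfl⟩
    · rintro ⟨x, ⟨hx, ht⟩, rfl⟩
      exact ⟨hx, ht, x.2.2⟩
  rw [hfac]
  refine ⟨hG.comp hΦ, (Set.finite_range G).subset ?_⟩
  rintro _ ⟨ω, rfl⟩
  exact ⟨Φ ω, rfl⟩

/-! ### (H0): the short-distance cutoff for medial polygons of interface lists -/

/-- Generic form of the short-distance cutoff for polylines: if the consecutive pairs of `a :: l` are pairwise
distinct and those whose segment meets `B̄(x, ρ)` all lie in the finite set `S`, the polyline through the images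
does not traverse `D(x; ρ, R)` by `2 (#S + 1) + 1` separate segments (`hasOrdConnectedCover_preimage_polylineFrom`,
`segMeetCount_map_le_card`, `le_of_hasTraversals_of_hasOrdConnectedCover`). -/
theorem not_hasTraversals_polyline_of_nodup {α : Type*} [DecidableEq α] (φ : α → ℂ) (a : α) (l : List α)
    (hnd : ((a :: l).zip l).Nodup) {x : ℂ} {ρ R : ℝ} (hρR : ρ < R) (S : Finset (α × α))
    (hS : ∀ pq ∈ (a :: l).zip l, (segment ℝ (φ pq.1) (φ pq.2) ∩ closedBall x ρ).Nonempty → pq ∈ S) :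
    ¬ (⟨Literature.Probability.LatticeModels.polyline ((a :: l).map φ)⟩ : Curve ℂ).HasTraversals
      (2 * (S.card + 1) + 1) x ρ R := by
  intro htr
  have hcov := hasOrdConnectedCover_preimage_polylineFrom (convex_closedBall x ρ) (φ a) (l.map φ)
  have hpre : (⟨Literature.Probability.LatticeModels.polyline ((a :: l).map φ)⟩ : Curve ℂ) ⁻¹' closedBall x ρ =
      (polylineFrom (φ a) (l.map φ)).2 ⁻¹' closedBall x ρ := rfl
  rw [← hpre] at hcov
  have hcount : segMeetCount (closedBall x ρ) (φ a) (l.map φ) ≤ S.card := segMeetCount_map_le_card _ φ a l S hnd hS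
  have hle := le_of_hasTraversals_of_hasOrdConnectedCover hρR (hcov.mono (Nat.add_le_add_right hcount 1)) htr
  omega

/-- The dart list of `a :: rest` closed up: the consecutive pairs of `a :: (rest ++ [a])` are the cyclic darts
`(a :: rest).zip ((a :: rest).rotate 1)`. -/
theorem zip_cons_append_singleton (a : MedialVertex) (rest : List MedialVertex) :
    (a :: (rest ++ [a])).zip (rest ++ [a]) = (a :: rest).zip ((a :: rest).rotate 1) := by
  rw [List.rotate_cons_succ, List.rotate_zero]
  have h := List.zip_append (l₁ := a :: rest) (r₁ := [a]) (l₂ := rest ++ [a]) (r₂ := ([] : List MedialVertex))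
    (by simp)
  simpa using h

/-- The box of sites of `ℓ∞`-radius `3` around `c`. -/
theorem card_siteBox (c : Site 2) :
    (Fintype.piFinset fun j : Fin 2 ↦ Finset.Icc (c j - 3) (c j + 3)).card = 49 := by
  rw [Fintype.card_piFinset]
  simp only [Fin.prod_univ_two, Int.card_Icc]
  have h : ∀ j : Fin 2, (c j + 3 + 1 - (c j - 3)).toNat = 7 := fun j ↦ by omega
  rw [h, h]
  rfl

/-- **(H0) for medial polygons of interface lists.**  At mesh `δ ∈ (0, 1]` the medial polygon of an interface
list traverses no shell `D(x; ρ, R)` with `ρ ≤ δ`, `ρ < R` by `395` separate segments: a segment of the polygon meeting `B̄(x, ρ)` joins the midpoints of the two edges of a corner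
whose vertex is within `3δ/2` of `x`, hence within `ℓ∞`-distance `3` (in lattice units) of the nearest site to `x`,
and the darts of an interface list are pairwise distinct (`IsInterfaceLoop.nodup`). -/
theorem not_hasTraversals_loopPolyline {ω : BondConfig (Site 2)} {γ : List MedialVertex} (h : IsInterfaceLoop ω γ)
    {δ : ℝ} (hδ : 0 < δ) {x : ℂ} {ρ R : ℝ} (hρδ : ρ ≤ δ) (hρR : ρ < R) :
    ¬ (⟨Literature.Probability.LatticeModels.polyline ((γ ++ γ.take 1).map (medialPoint δ))⟩ : Curve ℂ).HasTraversals
      (2 * (49 * 4 + 1) + 1) x ρ R := by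
  classical
  obtain ⟨a, rest, hγ⟩ := List.exists_cons_of_ne_nil h.ne_nil
  subst hγ
  have hlist : (a :: rest ++ (a :: rest).take 1) = a :: (rest ++ [a]) := by simp
  rw [hlist]
  -- the finite set of darts near `x`
  set c : Site 2 := nearestSite δ x with hc
  set B : Finset (Site 2) := Fintype.piFinset fun j : Fin 2 ↦ Finset.Icc (c j - 3) (c j + 3) with hB
  set S : Finset (MedialVertex × MedialVertex) :=
    (B ×ˢ (Finset.univ : Finset (Fin 4))).image fun p ↦ (cSrc p, cTgt p) with hS
  have hcard : S.card ≤ 49 * 4 := by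
    refine (Finset.card_image_le).trans ?_
    rw [Finset.card_product, card_siteBox, Finset.card_univ, Fintype.card_fin]
  intro htr
  refine not_hasTraversals_polyline_of_nodup (medialPoint δ) a (rest ++ [a]) ?_ hρR S ?_
    (htr.of_le (by omega))
  · rw [zip_cons_append_singleton]; exact h.nodup
  · intro pq hpq hmeet
    rw [zip_cons_append_singleton] at hpq
    obtain ⟨k, hk, hpqk⟩ := List.mem_iff_getElem.1 hpq
    have hk' : k < (a :: rest).length := by simpa using hk
    rw [h.getElem_zip_rotate_one hk'] at hpqk
    obtain ⟨p, hps, hpt⟩ := h.exists_corner k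
    have hsrc : cSrc p = pq.1 := by
      rw [hps, ← hpqk]; exact IsInterfaceLoop.getElem_idx_congr (Nat.mod_eq_of_lt hk') _
    have htgt : cTgt p = pq.2 := by rw [hpt, ← hpqk]
    rw [hS, Finset.mem_image]
    refine ⟨p, Finset.mem_product.2 ⟨?_, Finset.mem_univ _⟩, Prod.ext hsrc htgt⟩
    -- the corner vertex `p.1` is within `3δ/2 + δ` of the nearest site `c` to `x`
    obtain ⟨z, hzseg, hzball⟩ := hmeet
    obtain ⟨hds, hdt⟩ := dist_medialPoint_cSrc_cTgt p hδ.le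
    have hzp : dist z (meshPoint δ p.1) ≤ δ / 2 := by
      have hsub : segment ℝ (medialPoint δ pq.1) (medialPoint δ pq.2) ⊆ closedBall (meshPoint δ p.1) (δ / 2) :=
        (convex_closedBall _ _).segment_subset (by rw [mem_closedBall, ← hsrc]; exact hds.le)
          (by rw [mem_closedBall, ← htgt]; exact hdt.le)
      exact mem_closedBall.1 (hsub hzseg)
    have hpx : dist (meshPoint δ p.1) x ≤ δ / 2 + δ := by
      rw [mem_closedBall] at hzball
      calc dist (meshPoint δ p.1) x ≤ dist (meshPoint δ p.1) z + dist z x := dist_triangle _ _ _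
        _ ≤ δ / 2 + ρ := add_le_add (by rw [dist_comm]; exact hzp) hzball
        _ ≤ δ / 2 + δ := by linarith
    have hcx : dist (meshPoint δ c) x ≤ δ := dist_meshPoint_nearestSite_le hδ x
    have hpc : ‖meshPoint δ p.1 - meshPoint δ c‖ ≤ 5 / 2 * δ := by
      rw [← dist_eq_norm]
      linarith [dist_triangle (meshPoint δ p.1) x (meshPoint δ c), dist_comm x (meshPoint δ c)]
    rw [hB, Fintype.mem_piFinset]
    intro j
    rw [Finset.mem_Icc]
    have hcoord : |δ * ((p.1 j : ℝ) - (c j : ℝ))| ≤ 5 / 2 * δ := by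
      fin_cases j
      · have := (Complex.abs_re_le_norm _).trans hpc
        simpa [Complex.sub_re, meshPoint_re, mul_sub] using this
      · have := (Complex.abs_im_le_norm _).trans hpc
        simpa [Complex.sub_im, meshPoint_im, mul_sub] using this
    rw [abs_mul, abs_of_pos hδ] at hcoord
    have h' : |(p.1 j : ℝ) - (c j : ℝ)| ≤ 5 / 2 := by
      have := hcoord; nlinarith [abs_nonneg ((p.1 j : ℝ) - (c j : ℝ))]
    have h'' : |((p.1 j - c j : ℤ) : ℝ)| ≤ 5 / 2 := by push_cast; exact h'
    have hint : |p.1 j - c j| ≤ 2 := by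
      have : ((|p.1 j - c j| : ℤ) : ℝ) ≤ 5 / 2 := by rw [Int.cast_abs]; exact h''
      have h3 : ((|p.1 j - c j| : ℤ) : ℝ) < 3 := by linarith
      exact_mod_cast (Int.lt_add_one_iff.1 (by exact_mod_cast h3 : |p.1 j - c j| < 2 + 1))
    constructor <;> linarith [abs_le.1 hint]

end SoftMachine

/-! ### Tightness from the multiple-traversal estimate -/

/-- **Registered anchor** (`softMachine_isTightLaws_bondWinColl_of_traversalBound`): IF the whole-plane interface
loops of critical bond percolation on `ℤ²` obey the Aizenman–Burchard multiple-traversal estimate (H1) — stated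
inline, uniformly over restrictions `ω ∩ M` exactly as the tree's site-`𝕋` theorem
`triSitePercolation_exists_loop_hasTraversals_le`, and used only at `M = univ` — THEN for every radius `r` and type
`i` the laws of the typed windowed bond collections, `δ ∈ (0, 1]`, are tight on the Aizenman–Burchard space
(`LoopSpace.isTightLaws_map_of_traversalBounds` with `Λ = B̄(0, max r 0)`, the short-distance cutoff
`SoftMachine.not_hasTraversals_loopPolyline`, and the medial polygons of the interface lists with trace in
`B̄(0, r)` as the generating system). -/
theorem softMachine_isTightLaws_bondWinColl_of_traversalBound :
    (∃ (k : ℕ) (K lam : ℝ), 0 ≤ K ∧ 2 < lam ∧ ∀ (M : Set (Sym2 (Site 2))) (δ : ℝ), δ ∈ Set.Ioc (0 : ℝ) 1 →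
      ∀ (x : ℂ) (ρ R : ℝ), δ ≤ ρ → ρ < R → R ≤ 1 →
        bondPercolation (zdGraph 2) half {ω | ∃ γ : List MedialVertex, IsInterfaceLoop (ω ∩ M) γ ∧
          (⟨Literature.Probability.LatticeModels.polyline ((γ ++ γ.take 1).map (medialPoint δ))⟩ : Curve ℂ).HasTraversals
            k x ρ R} ≤ ENNReal.ofReal (K * (ρ / R) ^ lam)) →
    ∀ (r : ℝ) (i : Fin 2), IsTightLaws fun δ ↦ (bondPercolation (zdGraph 2) half).map fun ω ↦
      (Closeds.closure (loopCurve δ 0 '' {γ : List MedialVertex | IsInterfaceLoop ω γ ∧ loopType γ = i ∧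
        (loopCurve δ 0 γ).range ⊆ closedBall (0 : ℂ) r}) : LoopSpace ℂ) := by
  rintro ⟨k₁, K, lam, hK, hlam, hH1⟩ r i
  set k₀ : ℕ := 2 * (49 * 4 + 1) + 1 with hk₀
  set r₀ : ℝ := max r 0 with hr₀
  have hr₀0 : 0 ≤ r₀ := le_max_right _ _
  -- the generating system: medial polygons of the interface lists with trace in the closed disc
  set X : ℝ → BondConfig (Site 2) → Set (Curve ℂ) := fun δ ω ↦
    {γc | ∃ γ : List MedialVertex, IsInterfaceLoop ω γ ∧ (loopCurve δ 0 γ).range ⊆ closedBall (0 : ℂ) r ∧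
      γc = ⟨Literature.Probability.LatticeModels.polyline ((γ ++ γ.take 1).map (medialPoint δ))⟩} with hX
  refine LoopSpace.isTightLaws_map_of_traversalBounds (E := ℂ) (isCompact_closedBall (0 : ℂ) r₀)
    (C := 9 * (r₀ + 2) ^ 2) (d := 2) zero_le_two
    (fun ρ hρ hρ1 ↦ exists_finset_card_le_cover_closedBall hr₀0 ρ hρ hρ1)
    (Ω := fun _ ↦ BondConfig (Site 2)) (fun _ ↦ bondPercolation (zdGraph 2) half) X _
    (fun _ _ _ ↦ max k₀ k₁) hK hlam ?_ ?_ ?_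
  · -- the typed collection is generated by `X`
    intro δ _ ω c hc
    refine closure_mono ?_ hc
    rintro _ ⟨γ, ⟨hγ, -, hr⟩, rfl⟩
    exact ⟨_, ⟨γ, hγ, hr, rfl⟩, (loopCurve_zero δ γ).symm⟩
  · -- (H0)
    rintro δ ⟨hδ0, hδ1⟩
    refine ae_of_all _ fun ω γc hγc ↦ ?_
    obtain ⟨γ, hγ, hr, rfl⟩ := hγc
    refine ⟨?_, fun x ρ R hρ hρδ hρR htr ↦ ?_⟩
    · have e : (⟨Literature.Probability.LatticeModels.polyline ((γ ++ γ.take 1).map (medialPoint δ))⟩ : Curve ℂ).range =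
          (loopCurve δ 0 γ).range := by rw [loopCurve_zero, CurveClass.range_mk]
      rw [e]
      exact hr.trans (closedBall_subset_closedBall (le_max_left _ _))
    · exact SoftMachine.not_hasTraversals_loopPolyline hγ hδ0 hρδ hρR (htr.of_le (le_max_left _ _))
  · -- (H1), at `M = univ`
    intro δ hδ x ρ R hδρ hρR hR1
    refine le_trans (measure_mono ?_) (hH1 Set.univ δ hδ x ρ R hδρ hρR hR1)
    rintro ω ⟨γc, ⟨γ, hγ, -, rfl⟩, htr⟩
    exact ⟨γ, by rwa [Set.inter_univ], htr.of_le (le_max_right _ _)⟩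

end Summit.CriticalPhenomena.CardyFormulaZ2.Cruxes.NestingRigidity.PositiveConeWeightDoubling

end
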